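import Summits.ResolutionOfSingularities.ResolutionOfSingularities.Theorems.FrobeniusLadderFInjectiveMacaulayficationBlowupFiModelOfCover
import Summits.ResolutionOfSingularities.ResolutionOfSingularities.Theorems.FrobeniusLadderFInjectiveMacaulayficationPointCentreOfCertifiedCharts
import Summits.ResolutionOfSingularities.ResolutionOfSingularities.Theorems.FrobeniusLadderFInjectiveMacaulayficationClosedPointsOfClosedFinite
import HarnessLib

/-!
# A point-centre from COVER certificates on one affine chart, and hypothesis (ii) of G-β-rel for the certified-chart class
# (crux `FInjectiveMacaulayfication`, T-𝒫 programme §2a · §2b · §2c(ii))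

[OURS · L1 W4.5a · res-L1-w45a-stub-3] Support file (`--supports stmt-ResolutionOfSingularities-15315 --as helper`) for the crux
`FrobeniusLadder.FInjectiveMacaulayfication`; NOT a statement of any manuscript; AI-written, weaker than expert review. Statements =
the planner's sketch file `L/w45a/ClassGlueSig.lean` v2 sha16 239444958d057f2d, §2a `stub_affineBlowupStalkClauseOfCover`, §2b
`stub_pointCentreOfCoverCertificates`, §2c(ii) `stub_certifiedChartClass_h4`, VERBATIM with the `stub_` prefix dropped
(rulings R10.1–R10.4, HOME/STATUS 2026-08-27T06:17:21Z; SIG v2 06:37:30Z).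

THE PROGRAMME T-𝒫 («engine-class door theorem», zero named facts): G-β-rel `SequentialSurgeryGlueOfClass.sequentialSurgeryGlueOfClass`
(p505685) turns (ii) closed centres at the bad points OF A CLASS `P` + (iii) transport of `P` along blowing ups off the centre into a
Cohen–Macaulay F-injective model of every admissible pair all of whose bad points lie in `P`. For the CERTIFIED-CHART CLASS `P_cert`
(inside every open `W ∋ b` an affine open `U ∋ b`, alone-bad, `char Γ(X₁, U) = p`, an ideal `I ≠ 0` with zero locus `{b}` and a
COVERING family `v` in `I` — `R[It]₊ ⊆ √(v_j t)` — whose affine blow-up algebras `Γ(U)[I/v_j]` satisfy the Cohen–Macaulay +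
Frobenius-closed clause at their maximal ideals containing `v_j/1`: the certificate format of E6‴ `BlowupFiModelOfCover`) this
file supplies (ii):

* §2a `affineBlowupStalkClauseOfCover` — E6‴ (`BlowupFiModelOfCover.stub_blowupFiModelOfCover`) in STALK form: under its
  hypotheses EVERY stalk of `affineBlowup I` satisfies the full clause (domain ∧ CM ∧ Frobenius-closed parameter ideals). Proof = the
  pointwise body of E6‴ (`exists_stalk_ringEquiv_of_cover`, `BlowupFiModel.chart_fiClause_of_maximal`,
  `chartClause_of_blowupAlgebraClause`, `DegreeZeroDescent.inlineClause_of_ringEquiv`).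
* §2b `pointCentreOfCoverCertificates` — `PointCentreOfCertifiedCharts.stub_pointCentreOfCertifiedCharts` (p158302) with the
  certificates in E6‴'s COVER format: the point-centre ideal sheaf `J` of `I` (`PointCentreIdealSheaf`, p148869) has `supp J = {b}`,
  and every blowing up `π` of `X₁` along `J` has over `U` the stalks of `affineBlowup (J(U)) = affineBlowup I` (`BlowupStalkOverAffine`,
  p141181), which satisfy the full clause by §2a from the certificates and the clause off `b` on `U` (`ClauseOffCentre`, p141324).
* §2c(ii) `certifiedChartClass_h4` — hypothesis (ii) of G-β-rel for `P := P_cert`: at a bad closed point `b` with `P_cert X₁ f₁ b`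
  take `W = ⊤`; the clause off `b` on `U` holds because `b` is the only F-bad point of `U` and `X₁` is integral (domain stalks) and
  everywhere Cohen–Macaulay; §2b gives a point-centre, which is a closed centre in (β₄)'s sense since `supp J = {b}`. A PARTIAL
  PRODUCER for hole #4β (composition of record `OfFactsClosedCentre`).

References: The Stacks Project, Tag 0804 (affine blow-up algebras cover the blowing up); the rest is folklore.
-/

-- single-problem summit: the doubled namespace component is forced
set_option linter.dupNamespace false

noncomputable section

namespace Summit.ResolutionOfSingularities.ResolutionOfSingularities.Theorems.FInjectiveMacaulayfication.CertifiedChartCentre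

open AlgebraicGeometry CategoryTheory Literature.AlgebraicGeometry.Resolution
open Summit.ResolutionOfSingularities.ResolutionOfSingularities.Theorems.FInjectiveMacaulayfication

/-! ## §2a E6‴ in stalk form -/

/-- **§2a (E6‴, stalk form)** (`ClassGlueSig` v2 239444958d057f2d `stub_affineBlowupStalkClauseOfCover`, verbatim): `R` a
Noetherian domain of characteristic `p`, `I ≠ 0`, a family `v` of non-zero elements of `I` whose Rees charts cover
(`R[It]₊ ⊆ √(v₁t, …, v_tt)`), the full clause at every prime `P ⊉ I`, and the Cohen–Macaulay + Frobenius-closed clause at the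
maximal ideals containing `v_j` of every affine blow-up algebra `R[I/v_j]`. Then EVERY stalk of `affineBlowup I` is a domain all
of whose systems of parameters are weakly regular and generate Frobenius-closed ideals. Proof = the pointwise body of
`BlowupFiModelOfCover.stub_blowupFiModelOfCover`. [cite: StacksProject, Tag 0804] -/
theorem affineBlowupStalkClauseOfCover : ∀ (p : ℕ) [Fact p.Prime] (R : Type) [CommRing R] [IsDomain R] [IsNoetherianRing R]
    [CharP R p] (I : Ideal R) (t : ℕ) (v : Fin t → R) (hv : ∀ j : Fin t, v j ∈ I), I ≠ ⊥ → (∀ j : Fin t, v j ≠ 0) →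
    (HomogeneousIdeal.irrelevant (reesGrading I)).toIdeal ≤
      (Ideal.span (Set.range fun j : Fin t => reesT (I := I) (v j) (hv j))).radical →
    (∀ (P : Ideal R) [P.IsPrime], ¬ I ≤ P → IsDomain (Localization.AtPrime P) ∧ ∀ d : ℕ, ringKrullDim (Localization.AtPrime P) = d → ∀ s : Fin d → Localization.AtPrime P, (Ideal.span (Set.range s)).radical.IsMaximal → RingTheory.Sequence.IsWeaklyRegular (Localization.AtPrime P) (List.ofFn s) ∧ ∀ y : Localization.AtPrime P, (∃ e : ℕ, y ^ p ^ e ∈ Ideal.span ((fun z : Localization.AtPrime P => z ^ p ^ e) '' (Ideal.span (Set.range s) : Set (Localization.AtPrime P)))) → y ∈ Ideal.span (Set.range s)) →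
    (∀ (j : Fin t) (Q : Ideal (Literature.AlgebraicGeometry.Resolution.blowupAlgebra I (v j))) [Q.IsMaximal],
      algebraMap R (Literature.AlgebraicGeometry.Resolution.blowupAlgebra I (v j)) (v j) ∈ Q → ∀ d : ℕ, ringKrullDim (Localization.AtPrime Q) = d → ∀ s : Fin d → Localization.AtPrime Q, (Ideal.span (Set.range s)).radical.IsMaximal → RingTheory.Sequence.IsWeaklyRegular (Localization.AtPrime Q) (List.ofFn s) ∧ ∀ y : Localization.AtPrime Q, (∃ e : ℕ, y ^ p ^ e ∈ Ideal.span ((fun z : Localization.AtPrime Q => z ^ p ^ e) '' (Ideal.span (Set.range s) : Set (Localization.AtPrime Q)))) → y ∈ Ideal.span (Set.range s)) →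
    ∀ x : ↥(affineBlowup I), IsDomain ((affineBlowup I).presheaf.stalk x) ∧ ∀ d : ℕ, ringKrullDim ((affineBlowup I).presheaf.stalk x) = d → ∀ s : Fin d → (affineBlowup I).presheaf.stalk x, (Ideal.span (Set.range s)).radical.IsMaximal → RingTheory.Sequence.IsWeaklyRegular ((affineBlowup I).presheaf.stalk x) (List.ofFn s) ∧ ∀ y : (affineBlowup I).presheaf.stalk x, (∃ e : ℕ, y ^ p ^ e ∈ Ideal.span ((fun z : (affineBlowup I).presheaf.stalk x => z ^ p ^ e) '' (Ideal.span (Set.range s) : Set ((affineBlowup I).presheaf.stalk x)))) → y ∈ Ideal.span (Set.range s) := by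
  intro p _ R _ _ _ _ I t v hv hI hv0 hcov hoff hon y
  obtain ⟨j, q, ⟨e⟩⟩ := BlowupFiModelOfCover.exists_stalk_ringEquiv_of_cover v hv hcov y
  have hoff' : ∀ (P : Ideal R) [P.IsPrime], v j ∉ P →
      IsDomain (Localization.AtPrime P) ∧
      ∀ d : ℕ, ringKrullDim (Localization.AtPrime P) = d → ∀ s : Fin d → Localization.AtPrime P,
        (Ideal.span (Set.range s)).radical.IsMaximal →
          RingTheory.Sequence.IsWeaklyRegular (Localization.AtPrime P) (List.ofFn s) ∧
          ∀ y : Localization.AtPrime P, (∃ e : ℕ, y ^ p ^ e ∈ Ideal.span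
            ((fun z : Localization.AtPrime P => z ^ p ^ e) ''
              (Ideal.span (Set.range s) : Set (Localization.AtPrime P)))) → y ∈ Ideal.span (Set.range s) :=
    fun P _ hxP => hoff P fun hle => hxP (hle (hv j))
  obtain ⟨hdom, hq⟩ := BlowupFiModel.chart_fiClause_of_maximal p (v j) (hv j) (hv0 j) hoff'
    (fun Q _ haQ => BlowupFiModelOfCover.chartClause_of_blowupAlgebraClause p (v j) (hv j) (hon j) Q haQ) q.asIdeal
  haveI := hdom
  exact ⟨MulEquiv.isDomain (Localization.AtPrime q.asIdeal) e.toMulEquiv,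
    DegreeZeroDescent.inlineClause_of_ringEquiv p e.symm hq⟩

/-! ## §2b A point-centre from cover certificates -/

/-- **§2b — A POINT-CENTRE FROM COVER CERTIFICATES** (`ClassGlueSig` v2 239444958d057f2d `stub_pointCentreOfCoverCertificates`,
verbatim): `X₁` integral and locally Noetherian; `b` a closed point of an affine open `U` with `char Γ(X₁, U) = p`; `I ≠ 0` an
ideal of `Γ(X₁, U)` with zero locus `{b}` in `U`; the full stalk clause at every point of `U` other than `b`; a covering family
`v` of `I` (Rees charts cover) whose affine blow-up algebras are certified (E6‴ format). Then there is an ideal sheaf `J ≠ ⊥` with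
`supp J = {b}` such that every blow-up of `X₁` along `J` satisfies the full clause at all its points over `b` — the point-centre
ideal sheaf of `I` (`PointCentreIdealSheaf.stub_pointCentreIdealSheaf`), read on the affine `U` through
`BlowupStalkOverAffine.stub_blowupStalkOverAffine`, `ClauseOffCentre.stub_clauseOffCentre` and §2a. Generalises
`PointCentreOfCertifiedCharts.stub_pointCentreOfCertifiedCharts` (all generators ↦ any covering sub-family). [folklore] -/
theorem pointCentreOfCoverCertificates : ∀ (p : ℕ) [Fact p.Prime] (X₁ : Scheme.{0}) [IsIntegral X₁]
    [IsLocallyNoetherian X₁] (b : X₁), IsClosed ({b} : Set X₁) →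
    ∀ (U : X₁.affineOpens), b ∈ (U : X₁.Opens) → CharP Γ(X₁, U) p → ∀ (I : Ideal Γ(X₁, U)), I ≠ ⊥ →
    (∀ (x : X₁) (hx : x ∈ (U : X₁.Opens)), I ≤ (U.2.primeIdealOf ⟨x, hx⟩).asIdeal ↔ x = b) →
    (∀ x : X₁, x ∈ (U : X₁.Opens) → x ≠ b → IsDomain (X₁.presheaf.stalk x) ∧ ∀ d : ℕ, ringKrullDim (X₁.presheaf.stalk x) = d → ∀ s : Fin d → X₁.presheaf.stalk x, (Ideal.span (Set.range s)).radical.IsMaximal → RingTheory.Sequence.IsWeaklyRegular (X₁.presheaf.stalk x) (List.ofFn s) ∧ ∀ y : X₁.presheaf.stalk x, (∃ e : ℕ, y ^ p ^ e ∈ Ideal.span ((fun z : X₁.presheaf.stalk x => z ^ p ^ e) '' (Ideal.span (Set.range s) : Set (X₁.presheaf.stalk x)))) → y ∈ Ideal.span (Set.range s)) →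
    (∃ (t : ℕ) (v : Fin t → Γ(X₁, U)) (hv : ∀ j : Fin t, v j ∈ I),
          (HomogeneousIdeal.irrelevant (reesGrading I)).toIdeal ≤ (Ideal.span (Set.range fun j : Fin t => reesT (I := I) (v j) (hv j))).radical ∧
          (∀ j : Fin t, v j ≠ 0) ∧
          ∀ (j : Fin t) (Q : Ideal (Literature.AlgebraicGeometry.Resolution.blowupAlgebra I (v j))) [Q.IsMaximal],
            algebraMap Γ(X₁, U) (Literature.AlgebraicGeometry.Resolution.blowupAlgebra I (v j)) (v j) ∈ Q →
            ∀ d : ℕ, ringKrullDim (Localization.AtPrime Q) = d → ∀ s : Fin d → Localization.AtPrime Q, (Ideal.span (Set.range s)).radical.IsMaximal → RingTheory.Sequence.IsWeaklyRegular (Localization.AtPrime Q) (List.ofFn s) ∧ ∀ y : Localization.AtPrime Q, (∃ e : ℕ, y ^ p ^ e ∈ Ideal.span ((fun z : Localization.AtPrime Q => z ^ p ^ e) '' (Ideal.span (Set.range s) : Set (Localization.AtPrime Q)))) → y ∈ Ideal.span (Set.range s)) →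
    ∃ J : X₁.IdealSheafData, J ≠ ⊥ ∧ (J.support : Set X₁) = {b} ∧
      ∀ (X' : Scheme.{0}) (π : X' ⟶ X₁), Literature.AlgebraicGeometry.Resolution.IsBlowup π J →
        ∀ x' : X', π.base x' = b → IsDomain (X'.presheaf.stalk x') ∧ ∀ d : ℕ, ringKrullDim (X'.presheaf.stalk x') = d → ∀ s : Fin d → X'.presheaf.stalk x', (Ideal.span (Set.range s)).radical.IsMaximal → RingTheory.Sequence.IsWeaklyRegular (X'.presheaf.stalk x') (List.ofFn s) ∧ ∀ y : X'.presheaf.stalk x', (∃ e : ℕ, y ^ p ^ e ∈ Ideal.span ((fun z : X'.presheaf.stalk x' => z ^ p ^ e) '' (Ideal.span (Set.range s) : Set (X'.presheaf.stalk x')))) → y ∈ Ideal.span (Set.range s) := by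
  intro p _ X₁ _ _ b hb U hbU hchar I hI0 hzero hoffU hon
  -- the point-centre ideal sheaf of `I`
  obtain ⟨J, hJU, hsupp, -⟩ := PointCentreIdealSheaf.stub_pointCentreIdealSheaf X₁ U I b hbU hb hzero
  subst hJU
  refine ⟨J, fun hbot => hI0 (by rw [hbot]; rfl), hsupp, fun X' π hπ x' hx' => ?_⟩
  -- `Γ(X₁, U)` is a Noetherian domain of characteristic `p`
  haveI : Nonempty (U : X₁.Opens) := ⟨⟨b, hbU⟩⟩
  haveI : IsDomain Γ(X₁, U) := IsIntegral.component_integral (U : X₁.Opens)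
  haveI : IsNoetherianRing Γ(X₁, U) := IsLocallyNoetherian.component_noetherian U
  haveI : CharP Γ(X₁, U) p := hchar
  -- the stalk of `X'` at `x'` is a stalk of `affineBlowup (J(U))`
  obtain ⟨y, ⟨e⟩⟩ := BlowupStalkOverAffine.stub_blowupStalkOverAffine X₁ X' J π hπ U x' (hx' ▸ hbU)
  -- every stalk of `affineBlowup (J(U))` satisfies the full clause (§2a), from the clause off `b` on `U` and the certificates
  obtain ⟨t, v, hv, hcov, hv0, hcharts⟩ := hon
  have hoff' := ClauseOffCentre.stub_clauseOffCentre p X₁ J U fun z hzU hz => hoffU z hzU (by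
    intro hzb
    apply hz
    rw [hsupp, hzb]
    exact Set.mem_singleton b)
  have hall := affineBlowupStalkClauseOfCover p Γ(X₁, U) (J.ideal U) t v hv hI0 hv0 hcov
    (fun P _ hP => hoff' P hP) hcharts y
  exact fiClause_of_ringEquiv p e.symm hall

/-! ## §2c(ii) Closed centres exist on the certified-chart class -/

/-- **§2c (ii) — CLOSED CENTRES EXIST ON THE CERTIFIED-CHART CLASS** (`ClassGlueSig` v2 239444958d057f2d
`stub_certifiedChartClass_h4`, verbatim = hypothesis (ii) of G-β-rel `SequentialSurgeryGlueOfClass.sequentialSurgeryGlueOfClass`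
for `P := P_cert`): at a bad closed point `b` of an admissible pair `(X₁, f₁)` (separated, locally of finite type, quasi-compact
over `k` of characteristic `p`, integral, everywhere Cohen–Macaulay, finite bad set) carrying a certified chart inside every open
neighbourhood, SOME ideal sheaf `J ≠ ⊥` with `b ∈ supp J` has all its blowing ups satisfying the full clause over `supp J`. Proof:
take `W = ⊤` in `P_cert`; on the resulting affine `U` the full clause holds off `b` (domain stalks since `X₁` is integral,
Cohen–Macaulay by hypothesis, Frobenius clause by the alone-bad conjunct); `X₁` is locally Noetherian
(`ClosedPointsOfClosedFinite.isNoetherian_of_locallyOfFiniteType_of_quasiCompact`); §2b gives a point-centre with `supp J = {b}`.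
[folklore] -/
theorem certifiedChartClass_h4 : ∀ (p : ℕ), p.Prime → ∀ (k : Type) [Field k] [CharP k p]
    (X₁ : Scheme.{0}) (f₁ : X₁ ⟶ Spec (.of k)),
      IsSeparated f₁ → LocallyOfFiniteType f₁ → QuasiCompact f₁ → IsIntegral X₁ →
      (∀ x : X₁, ∀ d : ℕ, ringKrullDim (X₁.presheaf.stalk x) = d → ∀ s : Fin d → X₁.presheaf.stalk x, (Ideal.span (Set.range s)).radical.IsMaximal → RingTheory.Sequence.IsWeaklyRegular (X₁.presheaf.stalk x) (List.ofFn s)) →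
      Set.Finite {x : X₁ | ¬ ∀ d : ℕ, ringKrullDim (X₁.presheaf.stalk x) = d → ∀ s : Fin d → X₁.presheaf.stalk x, (Ideal.span (Set.range s)).radical.IsMaximal → ∀ y : X₁.presheaf.stalk x, (∃ e : ℕ, y ^ p ^ e ∈ Ideal.span ((fun z : X₁.presheaf.stalk x => z ^ p ^ e) '' (Ideal.span (Set.range s) : Set (X₁.presheaf.stalk x)))) → y ∈ Ideal.span (Set.range s)} →
      ∀ b : X₁, IsClosed ({b} : Set X₁) → (¬ ∀ d : ℕ, ringKrullDim (X₁.presheaf.stalk b) = d → ∀ s : Fin d → X₁.presheaf.stalk b, (Ideal.span (Set.range s)).radical.IsMaximal → ∀ y : X₁.presheaf.stalk b, (∃ e : ℕ, y ^ p ^ e ∈ Ideal.span ((fun z : X₁.presheaf.stalk b => z ^ p ^ e) '' (Ideal.span (Set.range s) : Set (X₁.presheaf.stalk b)))) → y ∈ Ideal.span (Set.range s)) →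
      (∀ W : X₁.Opens, b ∈ W → ∃ U : X₁.affineOpens, (U : X₁.Opens) ≤ W ∧ b ∈ (U : X₁.Opens) ∧
        (∀ x : X₁, x ∈ (U : X₁.Opens) → x ≠ b → ∀ d : ℕ, ringKrullDim (X₁.presheaf.stalk x) = d → ∀ s : Fin d → X₁.presheaf.stalk x, (Ideal.span (Set.range s)).radical.IsMaximal → ∀ y : X₁.presheaf.stalk x, (∃ e : ℕ, y ^ p ^ e ∈ Ideal.span ((fun z : X₁.presheaf.stalk x => z ^ p ^ e) '' (Ideal.span (Set.range s) : Set (X₁.presheaf.stalk x)))) → y ∈ Ideal.span (Set.range s)) ∧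
        CharP Γ(X₁, U) p ∧ ∃ (I : Ideal Γ(X₁, U)), I ≠ ⊥ ∧
        (∀ (x : X₁) (hx : x ∈ (U : X₁.Opens)), I ≤ (U.2.primeIdealOf ⟨x, hx⟩).asIdeal ↔ x = b) ∧
        ∃ (t : ℕ) (v : Fin t → Γ(X₁, U)) (hv : ∀ j : Fin t, v j ∈ I),
          (HomogeneousIdeal.irrelevant (reesGrading I)).toIdeal ≤ (Ideal.span (Set.range fun j : Fin t => reesT (I := I) (v j) (hv j))).radical ∧
          (∀ j : Fin t, v j ≠ 0) ∧
          ∀ (j : Fin t) (Q : Ideal (Literature.AlgebraicGeometry.Resolution.blowupAlgebra I (v j))) [Q.IsMaximal],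
            algebraMap Γ(X₁, U) (Literature.AlgebraicGeometry.Resolution.blowupAlgebra I (v j)) (v j) ∈ Q →
            ∀ d : ℕ, ringKrullDim (Localization.AtPrime Q) = d → ∀ s : Fin d → Localization.AtPrime Q, (Ideal.span (Set.range s)).radical.IsMaximal → RingTheory.Sequence.IsWeaklyRegular (Localization.AtPrime Q) (List.ofFn s) ∧ ∀ y : Localization.AtPrime Q, (∃ e : ℕ, y ^ p ^ e ∈ Ideal.span ((fun z : Localization.AtPrime Q => z ^ p ^ e) '' (Ideal.span (Set.range s) : Set (Localization.AtPrime Q)))) → y ∈ Ideal.span (Set.range s)) →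
      ∃ J : X₁.IdealSheafData, J ≠ ⊥ ∧ b ∈ (J.support : Set X₁) ∧
        ∀ (X' : Scheme.{0}) (π : X' ⟶ X₁), Literature.AlgebraicGeometry.Resolution.IsBlowup π J →
          ∀ x' : X', π.base x' ∈ (J.support : Set X₁) → IsDomain (X'.presheaf.stalk x') ∧ ∀ d : ℕ, ringKrullDim (X'.presheaf.stalk x') = d → ∀ s : Fin d → X'.presheaf.stalk x', (Ideal.span (Set.range s)).radical.IsMaximal → RingTheory.Sequence.IsWeaklyRegular (X'.presheaf.stalk x') (List.ofFn s) ∧ ∀ y : X'.presheaf.stalk x', (∃ e : ℕ, y ^ p ^ e ∈ Ideal.span ((fun z : X'.presheaf.stalk x' => z ^ p ^ e) '' (Ideal.span (Set.range s) : Set (X'.presheaf.stalk x')))) → y ∈ Ideal.span (Set.range s) := by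
  intro p hp k _ _ X₁ f₁ _ hft hqc hint hCM _ b hb _ hP
  haveI : Fact p.Prime := ⟨hp⟩
  haveI : IsNoetherian X₁ := ClosedPointsOfClosedFinite.isNoetherian_of_locallyOfFiniteType_of_quasiCompact f₁
  -- a certified chart around `b` (inside `W = ⊤`)
  obtain ⟨U, -, hbU, hF, hchar, I, hI0, hzero, hon⟩ := hP ⊤ trivial
  -- the full clause off `b` on `U`
  have hoffU : ∀ x : X₁, x ∈ (U : X₁.Opens) → x ≠ b →
      IsDomain (X₁.presheaf.stalk x) ∧ ∀ d : ℕ, ringKrullDim (X₁.presheaf.stalk x) = d →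
        ∀ s : Fin d → X₁.presheaf.stalk x, (Ideal.span (Set.range s)).radical.IsMaximal →
          RingTheory.Sequence.IsWeaklyRegular (X₁.presheaf.stalk x) (List.ofFn s) ∧
          ∀ y : X₁.presheaf.stalk x, (∃ e : ℕ, y ^ p ^ e ∈ Ideal.span
            ((fun z : X₁.presheaf.stalk x => z ^ p ^ e) ''
              (Ideal.span (Set.range s) : Set (X₁.presheaf.stalk x)))) → y ∈ Ideal.span (Set.range s) :=
    fun x hxU hxb => ⟨inferInstance, fun d hd s hs => ⟨hCM x d hd s hs, hF x hxU hxb d hd s hs⟩⟩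
  obtain ⟨J, hJ0, hsupp, hgood⟩ :=
    pointCentreOfCoverCertificates p X₁ b hb U hbU hchar I hI0 hzero hoffU hon
  refine ⟨J, hJ0, ?_, fun X' π hπ x' hx' => hgood X' π hπ x' ?_⟩
  · rw [hsupp]; exact Set.mem_singleton b
  · rw [hsupp] at hx'; exact Set.mem_singleton_iff.mp hx'

end Summit.ResolutionOfSingularities.ResolutionOfSingularities.Theorems.FInjectiveMacaulayfication.CertifiedChartCentre

end
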